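import Literature.MathematicalPhysics.QuantumFieldTheory.Balaban1983to89.B9Thm37GlueTorusCovComp

/-!
# `Balaban1983to89.B9Thm37GlueTorusCovLevels` — the LEVEL SUM of (3.16): Δ_U + Σ_j a_j·G_jᵀG_j for a finite
# family of covariant block means G_j carried by regions Λ_j, STRICTLY POSITIVE — and its Dirichlet compression
# to a domain Ω₀ invertible on Ω₀ — for EVERY isometric transport as soon as the regions COVER the sites (resp. Ω₀)
# (MODEL; own lineage pv21; imports `B9Thm37GlueTorusCovComp` only; modifies nothing)

References (bib keys; the tags below cite only these):
* [B9] = `Balaban1985BackgroundPropagators` — T. Bałaban, *Propagators for lattice gauge theories in a background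
  field*, Commun. Math. Phys. 99 (1985) 389–434.
* [B7] = `Balaban1985Averaging` — T. Bałaban, *Averaging operations for lattice gauge theories*, Commun. Math. Phys.
  98 (1985) 17–51 (= reference [5] of [B9]; only NAMED here, through `B9Thm37GlueTorusCovComp`).

THE PRINTED LOCUS (read as an image of the printed page; two NEW spans of [B9] p. 393, everything else only NAMED).
[B9] p. 393, between (3.15) and (3.16): «The only change we make is that the sequence (2.1) starts with Ω₀, thus we
have Ω₀ ⊃ Ω₁ ⊃ ⋯ ⊃ Ω_k, Ω_j ⊂ T_η, and we define Λ_j = Ω_j^{(j)}∖Ω_{j+1}^{(j)}, j = 0, 1, …, k, Ω_{k+1} = ∅, or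
Ω_j∖Ω_{j+1} = B^j(Λ_j), hence Λ_j ⊂ T^{(j)}_{L^jη}.» (print's dots "..." are rendered "⋯" / "…" here, nothing else
differs) and, immediately before (3.16): «We have introduced the domain Ω₀ because we will consider operators with
Dirichlet boundary conditions on Ω₀ᶜ. We define an operator Q\*aQ by the quadratic form» — display (3.16):
⟨A, Q\*aQA⟩ = Σ_{j=0}^{k} a Σ_{b∈Λ_j} (L^jη)^{d−2} |(Q_j(U)A)(b)|².  READING (a gloss, not a theorem): the sets
Ω_j∖Ω_{j+1} = B^j(Λ_j), j = 0, …, k, PARTITION Ω₀ (Ω_{k+1} = ∅); level j contributes the squares of the j-step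
averages Q_j(U)A at the j-lattice points b ∈ Λ_j with the positive coefficient a(L^jη)^{d−2}; level j = 0 (Q₀ = no
averaging) is a plain mass term on Λ₀.  Certified in the import closure and only NAMED here: (3.15)/(3.18)–(3.19)
p. 393 (the j-step averaging operators; `B9Thm37GlueTorusCov`, `B9Thm37GlueTorusCovComp`), (3.23)–(3.24) p. 394
(Δ′_a = Δ_U + Q′\*aQ′; `B9Thm37GlueTorusCov`), p. 394 *"Δ′_a↾_{Ω₀} = Ω₀Δ′_aΩ₀ … Its inverse is denoted by G′"* and
p. 395 *"Assuming some regularity of the configuration U it can be easily shown that the operator Δ′_a is positive.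
This implies positivity of the operators G′ …"* (`B9Thm37GlueTorusInv`, `B9Thm37Glue`).  NOTHING printed is
asserted as a theorem — every declaration below is a MODEL definition or a kernel-checked theorem about the
component model of the lineage (`B9Thm37Glue.covD`, `B9Thm37GlueTorusCov.Comb`, `B9Thm37GlueTorusCovComp.gMean`).

THE POINT (value = a MODEL kernel certificate steering the lineage; NOT summit progress).  `B9Thm37GlueTorusCovComp`
proved Δ_U + a·GᵀG strictly positive for ONE general covariant mean G whose site weights are > 0 EVERYWHERE, and
listed in its honest scope "no sum over the levels j = 0, …, k of (3.16) (one composite term with a free parameter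
a > 0), no Dirichlet data on Ω₀ᶜ".  THIS FILE supplies exactly that shape, for EVERY bond transport Rm (no flatness,
nesting or regularity of U anywhere):
 * §1 the LEVEL SUM `levelSum blk W T a = Σ_j a_j·G_jᵀG_j` over a finite index type J of general covariant means
   G_j = `gMean (blk j) (W j) (T j)` (all levels label their blocks in ONE type B — on the torus a block is labelled
   by its corner SITE, as the j-lattices T^{(j)} of print sit inside T_η), its value (`levelSum_apply`), quadratic
   form Σ_j a_j Σ_q (G_j f)(q)² (`qform_levelSum`) and symmetry (`isTransposePair_levelSum`).  The REGION Λ_j of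
   level j is where its site weight W_j is > 0 (W_j ≥ 0; print: L^{−jd} on B^j(Λ_j), 0 elsewhere); the
   coefficients a_j ≥ 0 are free (print: a(L^jη)^{d−2}).
 * §2 the LOCALIZED MECHANISM `gMean_ne_zero_of_pos`: if the transports of a mean G are isometries reproducing the
   field f from base values, W ≥ 0, and f(x₀, ·) ≠ 0 at ONE site with W(x₀) > 0, then G f ≠ 0 (the G-mean over the
   block of x₀ is (Σ_{block} W)·f(base) with Σ_{block} W ≥ W(x₀) > 0 and f(base) ≠ 0 by isometry); dually, a mean
   whose weights kill the field vanishes (`gMean_eq_zero_of_mul_eq_zero`).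
 * §3 the OPERATOR `levelOp … = D\*D + levelSum` (the model of Δ_U + Q\*aQ with (3.16); `levelOp_const`: a constant
   one-member family gives back `gLapCov` of `B9Thm37GlueTorusCovComp`), symmetric (`isTransposePair_levelOp`), with
   quadratic form Σ_b (∇_U f)(b)² + Σ_j a_j Σ_q (G_j f)(q)² ≥ 0 (`qform_levelOp`, `qform_levelOp_nonneg`).  MAIN
   ABSTRACT THEOREM `posDef_levelOp_of_cover`: isometric level transports reproducing every covariantly constant
   field from base values (`hrep`, discharged in §5–§6 for the identity, comb and two-comb levels), W_j ≥ 0, a_j ≥ 0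
   ⟹ the quadratic form is > 0 at every f ≠ 0 whose support is COVERED (every site x with some f(x, i) ≠ 0 has a
   level j with a_j > 0 and W_j(x) > 0): either ∇_U f ≠ 0, or f is covariantly constant and §2 applies at a covered
   site of its support.  Hence strictly positive, a unit, with a genuine two-sided `Ring.inverse`, when the regions
   cover ALL sites (`posDef_levelOp`, `isUnit_levelOp`, `inverse_mul_levelOp`, `mul_inverse_levelOp`).
 * §4 DIRICHLET ON Ω₀ (the model of print's G′ for the level sum).  For a {0,1}-valued χ (Ω₀ = {χ = 1}) such that
   the regions cover Ω₀, the operator `levelOp + M_{1−χ}` is strictly positive (`posDef_levelOp_add_compl`), its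
   Ω₀-sandwich is that of `levelOp` (`sandwich_add_compl`, hence `dirInv_add_compl`), and so the Dirichlet inverse
   G′ := `B9Thm37GlueTorusInv.dirInv (levelOp …) χ` satisfies Ω₀(Δ_U + Q\*aQ)Ω₀·G′ = Ω₀, G′·Ω₀(Δ_U + Q\*aQ)Ω₀ = Ω₀,
   Ω₀G′Ω₀ = G′ and G′ᵀ = G′ (`levelDir_right`, `levelDir_left`, `levelDir_supported`, `isTransposePair_levelDir`) —
   covering required on Ω₀ only, as in print (Ω₀ = ⊔_j B^j(Λ_j)).
 * §5 the IDENTITY LEVEL (Q₀ = 1; blk = id, T = 1): `one_orth`, `one_reproduces`, and `gMean_one_apply` — it is the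
   multiplication by W, i.e. a mass term on Λ₀.  The comb level (blk = base ∘ blk of a comb K, T = K.tr Rm) and the
   two-comb composite level are discharged BY NAME: `Comb.tr_orth`, `Comb.tr_reproduces` (`B9Thm37GlueTorusCov`),
   `twoLevel_orth`, `twoLevel_reproduces` (`B9Thm37GlueTorusCovComp`).
 * §6 the THREE-LEVEL FAMILY (k = 2 of (3.16)) over a fine comb K₁ and a coarse comb K on one bond structure, indexed
   by `Fin 3`: blockings `lvlBlk` (x ↦ x, x ↦ the K₁-base point of x, x ↦ the K-base point of that), transports
   `lvlTr` (1, K₁.tr, the ordered product of `B9Thm37GlueTorusCovComp`), `lvlTr_orth`, `lvlTr_reproduces`, operator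
   `threeLevelOp`; it is a unit for every isometric Rm, all bond weights ≠ 0, W_j ≥ 0 covering, a_j > 0
   (`isUnit_threeLevelOp`), in particular on the torus `UT N` with the lexicographic cube combs of sides M₀, M
   (`isUnit_threeLevelOp_torus`; positivity needs NO nesting; the level-1 blocking is the M₀-corner map and, under
   M₀ ∣ M, the level-2 blocking is the M-corner map: `lvlBlk_one_torus`, `lvlBlk_two_torus`).
 * §7 TWINS: the COVERING hypothesis is used — on a bondless two-site lattice with one identity level carried by one
   site, the indicator of the other site is in the kernel (`not_isUnit_levelOp_uncovered`, via
   `gMean_eq_zero_of_mul_eq_zero`); and on the 8-point circle with the flat quarter-turn transport `Rm8` of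
   `B9Thm37GlueTorusTwist` the three-level operator over `comb8`/`comb8c` IS a unit (`isUnit_threeLevel_twist8`).

NOT ASSERTED, NOT MODELLED (honest scope).  (i) As in `B9Thm37GlueTorusCovComp`: the averaged configurations Ū^i
of [B7] are NOT constructed; coarse transports are comb holonomies of U itself (§6) or free data (§1–§4).  (ii) The
regions Λ_j are arbitrary (any W_j ≥ 0): no geometry of the sequence Ω₀ ⊃ Ω₁ ⊃ ⋯ ⊃ Ω_k, no condition (2.2) of
print's [4], no relation between the region of level j and the j-blocks beyond what is put into W_j; the coefficients
a_j are free (the scale factors (L^jη)^{d−2}, L^{−jd} are not tracked).  (iii) (3.16) acts on algebra-valued bond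
fields A; the model acts, as the whole chain does, on component site fields `St × Cp → ℝ`.  (iv) Qualitative
positivity and invertibility only: no (3.17) (gauge-fixing density), no coercivity constant, no decay, no uniformity
in U beyond "isometric", nothing of Theorems 3.1–3.3, Corollary 3.6 or Theorem 3.7 of [B9]; the capstones of the
chain (`B9Thm37GlueTorusInv`, `…TorusRW`, `…TorusScaled`) are wired to the DIAGONAL mass and do not consume
`levelOp`.  Value = MODEL kernel certificate, NOT summit progress; NOT continuum, NOT Clay, NOT a claim about print
beyond the two quoted spans.
-/

namespace Literature.MathematicalPhysics.QuantumFieldTheory.Balaban1983to89.B9Thm37GlueTorusCovLevels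

open Finset B9Thm37Sum B9Thm37Glue B9Thm37GluePU B9Thm37GlueTorusInv B9Thm37GlueTorusTwist B9Thm37GlueTorusCov
  B9Thm37GlueTorusCovComp
open B5TorusCover (UT Ctr ctrU)

/-! ## §1  The level sum Σ_j a_j·G_jᵀG_j of a finite family of covariant block means -/

section LevelSum

variable {St B Cp J : Type} [Fintype St] [DecidableEq B] [Fintype Cp] [Fintype J]

/-- **MODEL of Q\*aQ of (3.16)**: the level sum Σ_j a_j·G_jᵀG_j of the finite family of general covariant block
means G_j = `gMean (blk j) (W j) (T j)` (blocking `blk j`, site weights `W j` carrying the region of level j,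
site transports `T j`) with level coefficients `a j`. [cite: Balaban1985BackgroundPropagators, (3.16) p.393] -/
def levelSum (blk : J → St → B) (W : J → St → ℝ) (T : J → St → Cp → Cp → ℝ) (a : J → ℝ) :
    Module.End ℝ (St × Cp → ℝ) :=
  ∑ j, a j • (gMeanT (blk j) (W j) (T j) ∘ₗ gMean (blk j) (W j) (T j))

/-- Unfolding of `levelSum`: (Q\*aQ f)(p) = Σ_j a_j (G_jᵀ(G_j f))(p). [folklore] -/
theorem levelSum_apply (blk : J → St → B) (W : J → St → ℝ) (T : J → St → Cp → Cp → ℝ) (a : J → ℝ)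
    (f : St × Cp → ℝ) (p : St × Cp) :
    levelSum blk W T a f p = ∑ j, a j * gMeanT (blk j) (W j) (T j) (gMean (blk j) (W j) (T j) f) p := by
  simp only [levelSum, LinearMap.sum_apply, Finset.sum_apply, LinearMap.smul_apply, LinearMap.comp_apply,
    Pi.smul_apply, smul_eq_mul]

variable [Fintype B]

/-- **The quadratic form of the level sum is (3.16)**: Σ_p f(p)(Q\*aQ f)(p) = Σ_j a_j Σ_q (G_j f)(q)².
[cite: Balaban1985BackgroundPropagators, (3.16) p.393] -/
theorem qform_levelSum (blk : J → St → B) (W : J → St → ℝ) (T : J → St → Cp → Cp → ℝ) (a : J → ℝ)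
    (f : St × Cp → ℝ) :
    ∑ p, f p * levelSum blk W T a f p =
      ∑ j, a j * ∑ q, gMean (blk j) (W j) (T j) f q * gMean (blk j) (W j) (T j) f q := by
  calc ∑ p, f p * levelSum blk W T a f p
      = ∑ p, ∑ j, a j * (f p * gMeanT (blk j) (W j) (T j) (gMean (blk j) (W j) (T j) f) p) := by
          refine Finset.sum_congr rfl fun p _ => ?_
          rw [levelSum_apply, Finset.mul_sum]
          exact Finset.sum_congr rfl fun j _ => by ring
    _ = ∑ j, ∑ p, a j * (f p * gMeanT (blk j) (W j) (T j) (gMean (blk j) (W j) (T j) f) p) := Finset.sum_comm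
    _ = ∑ j, a j * ∑ q, gMean (blk j) (W j) (T j) f q * gMean (blk j) (W j) (T j) f q := by
          refine Finset.sum_congr rfl fun j _ => ?_
          rw [← Finset.mul_sum, ← isTransposePair_gMean (blk j) (W j) (T j) f (gMean (blk j) (W j) (T j) f)]

/-- **Q\*aQ is symmetric** (a sum of multiples of the symmetric G_jᵀG_j). [cite: Balaban1985BackgroundPropagators, (3.16) p.393 + p.391] -/
theorem isTransposePair_levelSum (blk : J → St → B) (W : J → St → ℝ) (T : J → St → Cp → Cp → ℝ) (a : J → ℝ) :
    IsTransposePair (levelSum blk W T a) (levelSum blk W T a) := by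
  unfold levelSum
  exact IsTransposePair.sum fun j => isTransposePair_smul
    ((isTransposePair_gMean (blk j) (W j) (T j)).comp (isTransposePair_gMean (blk j) (W j) (T j)).symm) (a j)

end LevelSum

/-! ## §2  The localized mechanism: one covered site in the support of a reproduced field makes its mean non-zero -/

section Mechanism

variable {St B Cp : Type} [Fintype St] [DecidableEq B] [Fintype Cp]

/-- **The localized mechanism.**  If the transports of G are isometries reproducing f from base values
(Σ_j T(x)_{ij} f(x, j) = f(base(blk x), i)), the site weights are ≥ 0, and f(x₀, i₁) ≠ 0 at a site with W(x₀) > 0,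
then G f ≠ 0: at the block of x₀, (G f)(blk x₀, ·) = (Σ_{block} W)·f(base(blk x₀), ·) with Σ_{block} W ≥ W(x₀) > 0
and f(base(blk x₀), ·) = T(x₀)f(x₀, ·) ≠ 0. [folklore] -/
theorem gMean_ne_zero_of_pos [DecidableEq Cp] (blk : St → B) {W : St → ℝ} (hW : ∀ x, 0 ≤ W x) {T : St → Cp → Cp → ℝ}
    (hT : ∀ x i j, ∑ k, T x k i * T x k j = if i = j then (1 : ℝ) else 0) (base : B → St)
    {f : St × Cp → ℝ} (hrep : ∀ x i, ∑ j, T x i j * f (x, j) = f (base (blk x), i)) {x₀ : St}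
    (hx₀ : 0 < W x₀) {i₁ : Cp} (hf : f (x₀, i₁) ≠ 0) : gMean blk W T f ≠ 0 := by
  have hv : ∃ i₀, f (base (blk x₀), i₀) ≠ 0 := by
    by_contra hall
    simp only [not_exists, not_not] at hall
    have hzero := eq_zero_of_orth_apply_eq_zero (hT x₀) (fun j => f (x₀, j))
      (fun i => by rw [hrep x₀ i]; exact hall i)
    exact hf (by simpa using congrFun hzero i₁)
  obtain ⟨i₀, hi₀⟩ := hv
  intro hG
  have h := congrFun hG (blk x₀, i₀)
  rw [gMean_apply_of_reproduces blk W T base hrep, Pi.zero_apply] at h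
  have hpos : 0 < ∑ x ∈ univ.filter (fun x => blk x = blk x₀), W x :=
    lt_of_lt_of_le hx₀
      (Finset.single_le_sum (f := W) (fun x _ => hW x) (mem_filter.mpr ⟨mem_univ _, rfl⟩))
  exact mul_ne_zero hpos.ne' hi₀ h

/-- A mean whose weights kill the field vanishes: W(x)f(x, i) = 0 for all x, i ⟹ G f = 0 (any blocking, any
transports). [folklore] -/
theorem gMean_eq_zero_of_mul_eq_zero (blk : St → B) (W : St → ℝ) (T : St → Cp → Cp → ℝ) {f : St × Cp → ℝ}
    (h : ∀ x i, W x * f (x, i) = 0) : gMean blk W T f = 0 := by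
  funext q
  rw [gMean_apply, Pi.zero_apply]
  refine Finset.sum_eq_zero fun x _ => ?_
  split_ifs
  · rw [Finset.mul_sum]
    refine Finset.sum_eq_zero fun j _ => ?_
    calc W x * (T x q.2 j * f (x, j)) = T x q.2 j * (W x * f (x, j)) := by ring
      _ = 0 := by rw [h x j, mul_zero]
  · rfl

end Mechanism

/-! ## §3  The operator Δ_U + Σ_j a_j·G_jᵀG_j: quadratic form, symmetry, strict positivity under covering -/

section Operator

variable {St Bd B Cp J : Type} [Fintype St] [DecidableEq St] [Fintype Bd] [DecidableEq B] [Fintype Cp]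
  [Fintype J] (src tgt : Bd → St) (c : Bd → ℝ) (Rm : Bd → Cp → Cp → ℝ)

/-- **MODEL of Δ_U + Q\*aQ with the level sum (3.16)**: `levelOp … blk W T a = D\*D + Σ_j a_j·G_jᵀG_j` with
D = `covD`, D\* = `covDT` of `B9Thm37Glue`. [cite: Balaban1985BackgroundPropagators, (3.16) p.393 + (3.23)–(3.24) p.394] -/
def levelOp (blk : J → St → B) (W : J → St → ℝ) (T : J → St → Cp → Cp → ℝ) (a : J → ℝ) :
    Module.End ℝ (St × Cp → ℝ) :=
  covDT src tgt c Rm ∘ₗ covD src tgt c Rm + levelSum blk W T a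

/-- **Consistency with `B9Thm37GlueTorusCovComp`**: a constant family over a one-element index type gives back
`gLapCov … blk W T a` = Δ_U + a·GᵀG. [folklore] -/
theorem levelOp_const [Unique J] (blk : St → B) (W : St → ℝ) (T : St → Cp → Cp → ℝ) (a : ℝ) :
    levelOp src tgt c Rm (fun _ : J => blk) (fun _ => W) (fun _ => T) (fun _ => a) =
      gLapCov src tgt c Rm blk W T a := by
  rw [levelOp, levelSum, Finset.univ_unique, Finset.sum_singleton]
  rfl

variable [Fintype B]

/-- **Δ_U + Q\*aQ is symmetric.** [cite: Balaban1985BackgroundPropagators, (3.16) p.393 + p.391] -/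
theorem isTransposePair_levelOp (blk : J → St → B) (W : J → St → ℝ) (T : J → St → Cp → Cp → ℝ) (a : J → ℝ) :
    IsTransposePair (levelOp src tgt c Rm blk W T a) (levelOp src tgt c Rm blk W T a) :=
  (isTransposePair_covLap src tgt c Rm).add (isTransposePair_levelSum blk W T a)

/-- **The quadratic form of Δ_U + Q\*aQ**: Σ_p f(p)((D\*D + Σ_j a_j G_jᵀG_j)f)(p) = Σ_b (Df)(b)² + Σ_j a_j Σ_q (G_j f)(q)².
[cite: Balaban1985BackgroundPropagators, (3.16) p.393 + (3.23)–(3.24) p.394] -/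
theorem qform_levelOp (blk : J → St → B) (W : J → St → ℝ) (T : J → St → Cp → Cp → ℝ) (a : J → ℝ)
    (f : St × Cp → ℝ) :
    ∑ p, f p * levelOp src tgt c Rm blk W T a f p =
      ∑ b, covD src tgt c Rm f b * covD src tgt c Rm f b +
        ∑ j, a j * ∑ q, gMean (blk j) (W j) (T j) f q * gMean (blk j) (W j) (T j) f q := by
  rw [isTransposePair_covD src tgt c Rm f (covD src tgt c Rm f), ← qform_levelSum, ← Finset.sum_add_distrib]
  refine Finset.sum_congr rfl fun p _ => ?_
  simp only [levelOp, LinearMap.add_apply, Pi.add_apply, LinearMap.comp_apply]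
  ring

/-- The quadratic form of Δ_U + Q\*aQ is ≥ 0 for level coefficients ≥ 0 (sums of squares). [folklore] -/
theorem qform_levelOp_nonneg (blk : J → St → B) (W : J → St → ℝ) (T : J → St → Cp → Cp → ℝ) {a : J → ℝ}
    (ha : ∀ j, 0 ≤ a j) (f : St × Cp → ℝ) : 0 ≤ ∑ p, f p * levelOp src tgt c Rm blk W T a f p := by
  rw [qform_levelOp]
  exact add_nonneg (Finset.sum_nonneg fun b _ => mul_self_nonneg _)
    (Finset.sum_nonneg fun j _ => mul_nonneg (ha j) (Finset.sum_nonneg fun q _ => mul_self_nonneg _))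

/-- **MAIN ABSTRACT THEOREM (MODEL). Δ_U + Σ_j a_j·G_jᵀG_j is strictly positive on every non-zero field whose
support is COVERED by the regions**: the level transports are isometries (`hT`) reproducing every covariantly
constant field from base values (`hrep`: ∇_U f = 0 ⟹ Σ_k T_j(x)_{ik} f(x, k) = f(base_j(blk_j x), i)), W_j ≥ 0,
a_j ≥ 0, and every site x with some f(x, i) ≠ 0 has a level j with a_j > 0 and W_j(x) > 0 ⟹
Σ_p f(p)((Δ_U + Q\*aQ)f)(p) > 0 — for EVERY bond transport Rm, no flatness, nesting or regularity.
[cite: Balaban1985BackgroundPropagators, (3.16) p.393 + (3.23)–(3.24) p.394] -/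
theorem posDef_levelOp_of_cover [DecidableEq Cp] {blk : J → St → B} {W : J → St → ℝ}
    {T : J → St → Cp → Cp → ℝ} {a : J → ℝ} (hW : ∀ j x, 0 ≤ W j x) (ha : ∀ j, 0 ≤ a j)
    (hT : ∀ j x i i', ∑ k, T j x k i * T j x k i' = if i = i' then (1 : ℝ) else 0) (base : J → B → St)
    (hrep : ∀ j (f : St × Cp → ℝ), covD src tgt c Rm f = 0 →
      ∀ x i, ∑ k, T j x i k * f (x, k) = f (base j (blk j x), i))
    (f : St × Cp → ℝ) (hf : f ≠ 0) (hcov : ∀ x i, f (x, i) ≠ 0 → ∃ j, 0 < a j ∧ 0 < W j x) :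
    0 < ∑ p, f p * levelOp src tgt c Rm blk W T a f p := by
  rw [qform_levelOp]
  have hnn : ∀ j, 0 ≤ a j * ∑ q, gMean (blk j) (W j) (T j) f q * gMean (blk j) (W j) (T j) f q := fun j =>
    mul_nonneg (ha j) (Finset.sum_nonneg fun q _ => mul_self_nonneg _)
  by_cases hD : covD src tgt c Rm f = 0
  · obtain ⟨⟨x₀, i₁⟩, hx₀⟩ := Function.ne_iff.mp hf
    obtain ⟨j, haj, hWj⟩ := hcov x₀ i₁ hx₀
    obtain ⟨q₀, hq₀⟩ := Function.ne_iff.mp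
      (gMean_ne_zero_of_pos (blk j) (hW j) (hT j) (base j) (hrep j f hD) hWj hx₀)
    rw [hD]
    simp only [Pi.zero_apply, mul_zero, Finset.sum_const_zero, zero_add]
    refine lt_of_lt_of_le ?_ (Finset.single_le_sum
      (f := fun j => a j * ∑ q, gMean (blk j) (W j) (T j) f q * gMean (blk j) (W j) (T j) f q)
      (fun j _ => hnn j) (mem_univ j))
    exact mul_pos haj (lt_of_lt_of_le (mul_self_pos.mpr hq₀)
      (Finset.single_le_sum (f := fun q => gMean (blk j) (W j) (T j) f q * gMean (blk j) (W j) (T j) f q)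
        (fun q _ => mul_self_nonneg _) (mem_univ q₀)))
  · obtain ⟨b₀, hb₀⟩ := Function.ne_iff.mp hD
    exact add_pos_of_pos_of_nonneg
      (lt_of_lt_of_le (mul_self_pos.mpr hb₀)
        (Finset.single_le_sum (f := fun b => covD src tgt c Rm f b * covD src tgt c Rm f b)
          (fun b _ => mul_self_nonneg _) (mem_univ b₀)))
      (Finset.sum_nonneg fun j _ => hnn j)

/-- **Δ_U + Σ_j a_j·G_jᵀG_j is STRICTLY POSITIVE when the regions cover all sites** (every x has a level j with
a_j > 0, W_j(x) > 0), for every bond transport. [cite: Balaban1985BackgroundPropagators, (3.16) p.393 + (3.23)–(3.24) p.394] -/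
theorem posDef_levelOp [DecidableEq Cp] {blk : J → St → B} {W : J → St → ℝ} {T : J → St → Cp → Cp → ℝ}
    {a : J → ℝ} (hW : ∀ j x, 0 ≤ W j x) (ha : ∀ j, 0 ≤ a j)
    (hT : ∀ j x i i', ∑ k, T j x k i * T j x k i' = if i = i' then (1 : ℝ) else 0) (base : J → B → St)
    (hrep : ∀ j (f : St × Cp → ℝ), covD src tgt c Rm f = 0 →
      ∀ x i, ∑ k, T j x i k * f (x, k) = f (base j (blk j x), i))
    (hcov : ∀ x, ∃ j, 0 < a j ∧ 0 < W j x) (f : St × Cp → ℝ) (hf : f ≠ 0) :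
    0 < ∑ p, f p * levelOp src tgt c Rm blk W T a f p :=
  posDef_levelOp_of_cover src tgt c Rm hW ha hT base hrep f hf fun x _ _ => hcov x

/-- **Hence Δ_U + Σ_j a_j·G_jᵀG_j is a unit** (finite dimension) under covering. [folklore] -/
theorem isUnit_levelOp [DecidableEq Cp] {blk : J → St → B} {W : J → St → ℝ} {T : J → St → Cp → Cp → ℝ}
    {a : J → ℝ} (hW : ∀ j x, 0 ≤ W j x) (ha : ∀ j, 0 ≤ a j)
    (hT : ∀ j x i i', ∑ k, T j x k i * T j x k i' = if i = i' then (1 : ℝ) else 0) (base : J → B → St)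
    (hrep : ∀ j (f : St × Cp → ℝ), covD src tgt c Rm f = 0 →
      ∀ x i, ∑ k, T j x i k * f (x, k) = f (base j (blk j x), i))
    (hcov : ∀ x, ∃ j, 0 < a j ∧ 0 < W j x) : IsUnit (levelOp src tgt c Rm blk W T a) :=
  isUnit_of_posDef (posDef_levelOp src tgt c Rm hW ha hT base hrep hcov)

/-- `Ring.inverse` of Δ_U + Σ_j a_j·G_jᵀG_j is a genuine LEFT inverse under covering. [folklore] -/
theorem inverse_mul_levelOp [DecidableEq Cp] {blk : J → St → B} {W : J → St → ℝ} {T : J → St → Cp → Cp → ℝ}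
    {a : J → ℝ} (hW : ∀ j x, 0 ≤ W j x) (ha : ∀ j, 0 ≤ a j)
    (hT : ∀ j x i i', ∑ k, T j x k i * T j x k i' = if i = i' then (1 : ℝ) else 0) (base : J → B → St)
    (hrep : ∀ j (f : St × Cp → ℝ), covD src tgt c Rm f = 0 →
      ∀ x i, ∑ k, T j x i k * f (x, k) = f (base j (blk j x), i))
    (hcov : ∀ x, ∃ j, 0 < a j ∧ 0 < W j x) :
    Ring.inverse (levelOp src tgt c Rm blk W T a) * levelOp src tgt c Rm blk W T a = 1 :=
  inverse_mul_of_posDef (posDef_levelOp src tgt c Rm hW ha hT base hrep hcov)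

/-- `Ring.inverse` of Δ_U + Σ_j a_j·G_jᵀG_j is a genuine RIGHT inverse under covering. [folklore] -/
theorem mul_inverse_levelOp [DecidableEq Cp] {blk : J → St → B} {W : J → St → ℝ} {T : J → St → Cp → Cp → ℝ}
    {a : J → ℝ} (hW : ∀ j x, 0 ≤ W j x) (ha : ∀ j, 0 ≤ a j)
    (hT : ∀ j x i i', ∑ k, T j x k i * T j x k i' = if i = i' then (1 : ℝ) else 0) (base : J → B → St)
    (hrep : ∀ j (f : St × Cp → ℝ), covD src tgt c Rm f = 0 →
      ∀ x i, ∑ k, T j x i k * f (x, k) = f (base j (blk j x), i))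
    (hcov : ∀ x, ∃ j, 0 < a j ∧ 0 < W j x) :
    levelOp src tgt c Rm blk W T a * Ring.inverse (levelOp src tgt c Rm blk W T a) = 1 :=
  mul_inverse_of_posDef (posDef_levelOp src tgt c Rm hW ha hT base hrep hcov)

/-! ## §4  Dirichlet boundary conditions on Ω₀ᶜ: the Dirichlet inverse G′ of Ω₀(Δ_U + Q\*aQ)Ω₀ under covering of Ω₀ -/

/-- **Positivity of (Δ_U + Q\*aQ) + (1 − Ω₀) when the regions cover Ω₀ = {χ = 1}** (χ {0,1}-valued; e.g.
χ(x, i) = 𝟙_{Ω₀}(x)): a field with support meeting {χ = 0} is seen by the added mass, a field supported in Ω₀ by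
`posDef_levelOp_of_cover`. [cite: Balaban1985BackgroundPropagators, (3.16) p.393 + p.394] -/
theorem posDef_levelOp_add_compl [DecidableEq Cp] {blk : J → St → B} {W : J → St → ℝ}
    {T : J → St → Cp → Cp → ℝ} {a : J → ℝ} (hW : ∀ j x, 0 ≤ W j x) (ha : ∀ j, 0 ≤ a j)
    (hT : ∀ j x i i', ∑ k, T j x k i * T j x k i' = if i = i' then (1 : ℝ) else 0) (base : J → B → St)
    (hrep : ∀ j (f : St × Cp → ℝ), covD src tgt c Rm f = 0 →
      ∀ x i, ∑ k, T j x i k * f (x, k) = f (base j (blk j x), i))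
    {χ : St × Cp → ℝ} (hχ : ∀ p, χ p = 0 ∨ χ p = 1) (hcov : ∀ x i, χ (x, i) = 1 → ∃ j, 0 < a j ∧ 0 < W j x)
    (f : St × Cp → ℝ) (hf : f ≠ 0) :
    0 < ∑ p, f p * (levelOp src tgt c Rm blk W T a + mulOp (1 - χ) : Module.End ℝ (St × Cp → ℝ)) f p := by
  have hsplit : ∑ p, f p * (levelOp src tgt c Rm blk W T a + mulOp (1 - χ) : Module.End ℝ (St × Cp → ℝ)) f p =
      ∑ p, f p * levelOp src tgt c Rm blk W T a f p + ∑ p, (1 - χ) p * (f p * f p) := by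
    rw [← Finset.sum_add_distrib]
    refine Finset.sum_congr rfl fun p _ => ?_
    rw [LinearMap.add_apply, Pi.add_apply, mulOp_apply]
    ring
  rw [hsplit]
  have h1 : ∀ p, 0 ≤ (1 - χ) p * (f p * f p) := fun p =>
    mul_nonneg (by rcases hχ p with h | h <;> simp only [Pi.sub_apply, Pi.one_apply, h, sub_zero, sub_self,
      zero_le_one, le_refl]) (mul_self_nonneg _)
  by_cases hout : ∃ p, f p ≠ 0 ∧ χ p = 0
  · obtain ⟨p₀, hp₀, hχ₀⟩ := hout
    refine add_pos_of_nonneg_of_pos (qform_levelOp_nonneg src tgt c Rm blk W T ha f) ?_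
    refine lt_of_lt_of_le ?_
      (Finset.single_le_sum (f := fun p => (1 - χ) p * (f p * f p)) (fun p _ => h1 p) (mem_univ p₀))
    have h10 : (1 - χ) p₀ = 1 := by rw [Pi.sub_apply, Pi.one_apply, hχ₀, sub_zero]
    rw [h10, one_mul]
    exact mul_self_pos.mpr hp₀
  · refine add_pos_of_pos_of_nonneg ?_ (Finset.sum_nonneg fun p _ => h1 p)
    refine posDef_levelOp_of_cover src tgt c Rm hW ha hT base hrep f hf fun x i hxi => hcov x i ?_
    rcases hχ (x, i) with h | h
    · exact absurd ⟨(x, i), hxi, h⟩ hout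
    · exact h

/-- The Ω₀-sandwich does not see a mass added on Ω₀ᶜ: Ω₀(A + (1 − Ω₀))Ω₀ = Ω₀AΩ₀. [folklore] -/
theorem sandwich_add_compl {X : Type} [Fintype X] (A : Module.End ℝ (X → ℝ)) {χ : X → ℝ}
    (hχ : ∀ x, χ x = 0 ∨ χ x = 1) : mulOp χ * (A + mulOp (1 - χ)) * mulOp χ = mulOp χ * A * mulOp χ := by
  rw [mul_add, mulOp_mul_compl hχ, add_zero]

/-- Hence the Dirichlet inverse of `B9Thm37GlueTorusInv` does not see it either:
dirInv (A + (1 − Ω₀)) Ω₀ = dirInv A Ω₀. [folklore] -/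
theorem dirInv_add_compl {X : Type} [Fintype X] (A : Module.End ℝ (X → ℝ)) {χ : X → ℝ}
    (hχ : ∀ x, χ x = 0 ∨ χ x = 1) : dirInv (A + mulOp (1 - χ)) χ = dirInv A χ := by
  unfold dirInv
  rw [sandwich_add_compl A hχ]

/-- **The Dirichlet inverse G′ := `dirInv (Δ_U + Q\*aQ) Ω₀` is a RIGHT inverse of Ω₀(Δ_U + Q\*aQ)Ω₀ on Ω₀**:
Ω₀(Δ_U + Q\*aQ)Ω₀·G′ = Ω₀ — for every bond transport, the regions covering Ω₀ = {χ = 1}.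
[cite: Balaban1985BackgroundPropagators, (3.16) p.393 + p.394] -/
theorem levelDir_right [DecidableEq Cp] {blk : J → St → B} {W : J → St → ℝ} {T : J → St → Cp → Cp → ℝ}
    {a : J → ℝ} (hW : ∀ j x, 0 ≤ W j x) (ha : ∀ j, 0 ≤ a j)
    (hT : ∀ j x i i', ∑ k, T j x k i * T j x k i' = if i = i' then (1 : ℝ) else 0) (base : J → B → St)
    (hrep : ∀ j (f : St × Cp → ℝ), covD src tgt c Rm f = 0 →
      ∀ x i, ∑ k, T j x i k * f (x, k) = f (base j (blk j x), i))
    {χ : St × Cp → ℝ} (hχ : ∀ p, χ p = 0 ∨ χ p = 1) (hcov : ∀ x i, χ (x, i) = 1 → ∃ j, 0 < a j ∧ 0 < W j x) :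
    mulOp χ * levelOp src tgt c Rm blk W T a * mulOp χ * dirInv (levelOp src tgt c Rm blk W T a) χ = mulOp χ := by
  rw [← dirInv_add_compl _ hχ, ← sandwich_add_compl (levelOp src tgt c Rm blk W T a) hχ]
  exact sandwichΩ_mul_dirInv (posDef_levelOp_add_compl src tgt c Rm hW ha hT base hrep hχ hcov) hχ

/-- **… and a LEFT inverse**: G′·Ω₀(Δ_U + Q\*aQ)Ω₀ = Ω₀. [cite: Balaban1985BackgroundPropagators, (3.16) p.393 + p.394] -/
theorem levelDir_left [DecidableEq Cp] {blk : J → St → B} {W : J → St → ℝ} {T : J → St → Cp → Cp → ℝ}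
    {a : J → ℝ} (hW : ∀ j x, 0 ≤ W j x) (ha : ∀ j, 0 ≤ a j)
    (hT : ∀ j x i i', ∑ k, T j x k i * T j x k i' = if i = i' then (1 : ℝ) else 0) (base : J → B → St)
    (hrep : ∀ j (f : St × Cp → ℝ), covD src tgt c Rm f = 0 →
      ∀ x i, ∑ k, T j x i k * f (x, k) = f (base j (blk j x), i))
    {χ : St × Cp → ℝ} (hχ : ∀ p, χ p = 0 ∨ χ p = 1) (hcov : ∀ x i, χ (x, i) = 1 → ∃ j, 0 < a j ∧ 0 < W j x) :
    dirInv (levelOp src tgt c Rm blk W T a) χ * (mulOp χ * levelOp src tgt c Rm blk W T a * mulOp χ) = mulOp χ := by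
  rw [← dirInv_add_compl _ hχ, ← sandwich_add_compl (levelOp src tgt c Rm blk W T a) hχ]
  exact dirInv_mul_sandwichΩ (posDef_levelOp_add_compl src tgt c Rm hW ha hT base hrep hχ hcov) hχ

omit [Fintype B] in
/-- G′ lives on Ω₀: Ω₀G′Ω₀ = G′ (no hypothesis). [folklore] -/
theorem levelDir_supported (blk : J → St → B) (W : J → St → ℝ) (T : J → St → Cp → Cp → ℝ) (a : J → ℝ)
    {χ : St × Cp → ℝ} (hχ : ∀ p, χ p = 0 ∨ χ p = 1) :
    mulOp χ * dirInv (levelOp src tgt c Rm blk W T a) χ * mulOp χ = dirInv (levelOp src tgt c Rm blk W T a) χ :=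
  mulOp_mul_dirInv_mul_mulOp _ hχ

/-- **G′ is symmetric.** [cite: Balaban1985BackgroundPropagators, (3.16) p.393 + p.394 + p.391] -/
theorem isTransposePair_levelDir [DecidableEq Cp] {blk : J → St → B} {W : J → St → ℝ}
    {T : J → St → Cp → Cp → ℝ} {a : J → ℝ} (hW : ∀ j x, 0 ≤ W j x) (ha : ∀ j, 0 ≤ a j)
    (hT : ∀ j x i i', ∑ k, T j x k i * T j x k i' = if i = i' then (1 : ℝ) else 0) (base : J → B → St)
    (hrep : ∀ j (f : St × Cp → ℝ), covD src tgt c Rm f = 0 →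
      ∀ x i, ∑ k, T j x i k * f (x, k) = f (base j (blk j x), i))
    {χ : St × Cp → ℝ} (hχ : ∀ p, χ p = 0 ∨ χ p = 1) (hcov : ∀ x i, χ (x, i) = 1 → ∃ j, 0 < a j ∧ 0 < W j x) :
    IsTransposePair (dirInv (levelOp src tgt c Rm blk W T a) χ) (dirInv (levelOp src tgt c Rm blk W T a) χ) := by
  rw [← dirInv_add_compl _ hχ]
  exact isTransposePair_dirInv
    ((isTransposePair_levelOp src tgt c Rm blk W T a).add (isTransposePair_mulOp (1 - χ)))
    (posDef_levelOp_add_compl src tgt c Rm hW ha hT base hrep hχ hcov) hχ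

end Operator

/-! ## §5  The identity level (Q₀ = 1): a mass term on Λ₀ -/

section IdentityLevel

variable {St Cp : Type} [Fintype Cp] [DecidableEq Cp]

/-- The identity transport is an isometry. [folklore] -/
theorem one_orth (i j : Cp) :
    ∑ k, (if k = i then (1 : ℝ) else 0) * (if k = j then (1 : ℝ) else 0) = if i = j then (1 : ℝ) else 0 := by
  rw [Finset.sum_eq_single i (fun k _ hk => by rw [if_neg hk, zero_mul]) (fun h => absurd (mem_univ i) h),
    if_pos rfl, one_mul]

/-- The identity transport reproduces every field from its own value (base = blk = id; no ∇_U f = 0 needed). [folklore] -/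
theorem one_reproduces (f : St × Cp → ℝ) (x : St) (i : Cp) :
    ∑ j, (if i = j then (1 : ℝ) else 0) * f (x, j) = f (x, i) := by
  rw [Finset.sum_eq_single i (fun j _ hj => by rw [if_neg (Ne.symm hj), zero_mul])
    (fun h => absurd (mem_univ i) h), if_pos rfl, one_mul]

/-- **The identity level is the multiplication by its site weight** (the j = 0 term of (3.16), Q₀ = no averaging:
a mass term a·W on the region Λ₀ = {W > 0}): (G f)(x, i) = W(x)f(x, i) for blk = id, T = 1.
[cite: Balaban1985BackgroundPropagators, (3.16) p.393] -/
theorem gMean_one_apply [Fintype St] [DecidableEq St] (W : St → ℝ) (f : St × Cp → ℝ) (x : St) (i : Cp) :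
    gMean (fun y : St => y) W (fun (_ : St) (i j : Cp) => if i = j then (1 : ℝ) else 0) f (x, i) =
      W x * f (x, i) := by
  rw [gMean_apply, Finset.sum_eq_single x (fun y _ hy => if_neg hy) (fun h => absurd (mem_univ x) h), if_pos rfl,
    one_reproduces]

end IdentityLevel

/-! ## §6  The three-level family (k = 2) over a fine comb K₁ and a coarse comb K; the torus -/

section ThreeLevels

variable {St Bd B₁ B Cp : Type} [Fintype Cp] [DecidableEq Cp] {src tgt : Bd → St} (K₁ : Comb src tgt B₁)
  (K : Comb src tgt B) (Rm : Bd → Cp → Cp → ℝ)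

/-- MODEL: the blockings of the three levels, blocks labelled by representative SITES — level 0: x ↦ x (one-site
blocks); level 1: x ↦ the K₁-base point of the K₁-block of x; level 2: x ↦ the K-base point of the K-block of that
base point (the composite blocking of `B9Thm37GlueTorusCovComp` followed by `K.base`). [cite: Balaban1985BackgroundPropagators, (3.16) p.393 + (3.19) p.393] -/
def lvlBlk : Fin 3 → St → St
  | 0 => fun x => x
  | 1 => fun x => K₁.base (K₁.blk x)
  | 2 => fun x => K.base (K.blk (K₁.base (K₁.blk x)))

/-- MODEL: the transports of the three levels — level 0: the identity; level 1: the comb holonomy K₁.tr; level 2: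
the ORDERED PRODUCT (coarse·fine) of K's holonomy at the K₁-base point with K₁'s holonomy at x
(`B9Thm37GlueTorusCovComp.mmul`). [cite: Balaban1985BackgroundPropagators, (3.19) p.393] -/
def lvlTr : Fin 3 → St → Cp → Cp → ℝ
  | 0 => fun _ i j => if i = j then 1 else 0
  | 1 => fun x => K₁.tr Rm x
  | 2 => fun x => mmul (K.tr Rm (K₁.base (K₁.blk x))) (K₁.tr Rm x)

/-- All three level transports are isometries when every bond matrix is (`one_orth`, `Comb.tr_orth`,
`twoLevel_orth`). [folklore] -/
theorem lvlTr_orth (hRm : ∀ b i j, ∑ k, Rm b k i * Rm b k j = if i = j then (1 : ℝ) else 0) :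
    ∀ l x i j, ∑ k, lvlTr K₁ K Rm l x k i * lvlTr K₁ K Rm l x k j = if i = j then (1 : ℝ) else 0 := by
  intro l
  fin_cases l
  · exact fun _ => one_orth
  · exact K₁.tr_orth Rm hRm
  · exact twoLevel_orth K₁ K Rm hRm

/-- All three level transports reproduce covariantly constant fields from the value at the level's representative
site (`one_reproduces`, `Comb.tr_reproduces`, `twoLevel_reproduces`; all bond weights ≠ 0). [folklore] -/
theorem lvlTr_reproduces {c : Bd → ℝ} (hc : ∀ b, c b ≠ 0) {f : St × Cp → ℝ} (hD : covD src tgt c Rm f = 0) :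
    ∀ l x i, ∑ k, lvlTr K₁ K Rm l x i k * f (x, k) = f (lvlBlk K₁ K l x, i) := by
  intro l
  fin_cases l
  · exact fun x i => one_reproduces f x i
  · exact K₁.tr_reproduces Rm hc hD
  · exact twoLevel_reproduces K₁ K Rm hc hD

variable [Fintype St] [DecidableEq St] [Fintype Bd]

/-- **MODEL of Δ_U + Q\*aQ with k = 2**: Δ_U + a₀·M_{W₀}ᵀM_{W₀} + a₁·Q₁ᵀQ₁ + a₂·(Q₂Q₁)ᵀ(Q₂Q₁) — the level operator of
the three-level family over the combs K₁, K with site weights W_j (regions Λ_j = {W_j > 0}) and coefficients a_j.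
[cite: Balaban1985BackgroundPropagators, (3.16) p.393 + (3.23)–(3.24) p.394] -/
def threeLevelOp (c : Bd → ℝ) (W : Fin 3 → St → ℝ) (a : Fin 3 → ℝ) : Module.End ℝ (St × Cp → ℝ) :=
  levelOp src tgt c Rm (lvlBlk K₁ K) W (lvlTr K₁ K Rm) a

/-- **The three-level operator is a unit for EVERY isometric transport**, all bond weights ≠ 0, site weights ≥ 0
whose regions cover all sites, coefficients > 0 — any two combs on one bond structure, no nesting.
[cite: Balaban1985BackgroundPropagators, (3.16) p.393 + (3.23)–(3.24) p.394] -/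
theorem isUnit_threeLevelOp (hRm : ∀ b i j, ∑ k, Rm b k i * Rm b k j = if i = j then (1 : ℝ) else 0)
    {c : Bd → ℝ} (hc : ∀ b, c b ≠ 0) {W : Fin 3 → St → ℝ} (hW : ∀ l x, 0 ≤ W l x) {a : Fin 3 → ℝ}
    (ha : ∀ l, 0 < a l) (hcov : ∀ x, ∃ l, 0 < W l x) : IsUnit (threeLevelOp K₁ K Rm c W a) :=
  isUnit_levelOp src tgt c Rm hW (fun l => (ha l).le) (lvlTr_orth K₁ K Rm hRm) (fun _ y => y)
    (fun l _ hD => lvlTr_reproduces K₁ K Rm hc hD l) fun x => (hcov x).elim fun l hl => ⟨l, ha l, hl⟩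

end ThreeLevels

section Torus

variable {d : ℕ} {N : Fin d → ℕ} [∀ i, NeZero (N i)] [NeZero d]

/-- On the torus the level-1 blocking of the cube combs is the M₀-corner map x ↦ M₀·⌊x/M₀⌋ (`ctrU ∘ tblk`). [folklore] -/
theorem lvlBlk_one_torus {M₀ M : ℕ} (hM₀ : 1 ≤ M₀) (hdiv₀ : ∀ i, M₀ ∣ N i) (hM : 1 ≤ M) (hdiv : ∀ i, M ∣ N i)
    (x : UT N) : lvlBlk (torusComb hM₀ hdiv₀) (torusComb hM hdiv) 1 x = ctrU N M₀ (tblk hM₀ hdiv₀ x) := rfl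

/-- Under nesting M₀ ∣ M the level-2 blocking of the cube combs is the M-corner map (the M-block of the M₀-corner of
x is the M-block of x, `B9Thm37GlueTorusCovComp.tblk_ctrU_tblk`). [folklore] -/
theorem lvlBlk_two_torus {M₀ M : ℕ} (hM₀ : 1 ≤ M₀) (hdiv₀ : ∀ i, M₀ ∣ N i) (hM : 1 ≤ M) (hdiv : ∀ i, M ∣ N i)
    (hnest : M₀ ∣ M) (x : UT N) : lvlBlk (torusComb hM₀ hdiv₀) (torusComb hM hdiv) 2 x = ctrU N M (tblk hM hdiv x) := by
  show ctrU N M (tblk hM hdiv (ctrU N M₀ (tblk hM₀ hdiv₀ x))) = _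
  rw [tblk_ctrU_tblk hM₀ hdiv₀ hM hdiv hnest x]

/-- **Δ_U + a₀·M_{W₀}ᵀM_{W₀} + a₁·Q₁ᵀQ₁ + a₂·(Q₂Q₁)ᵀ(Q₂Q₁) on the torus with the lexicographic cube combs of sides
M₀, M is a unit for EVERY isometric transport**, all bond weights ≠ 0, site weights ≥ 0 covering the torus,
coefficients > 0 (1 ≤ M₀, M₀ ∣ N_i, 1 ≤ M, M ∣ N_i; no nesting needed). [folklore] -/
theorem isUnit_threeLevelOp_torus {Cp : Type} [Fintype Cp] [DecidableEq Cp] {M₀ M : ℕ} (hM₀ : 1 ≤ M₀)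
    (hdiv₀ : ∀ i, M₀ ∣ N i) (hM : 1 ≤ M) (hdiv : ∀ i, M ∣ N i) {Rm : UT N × Fin d → Cp → Cp → ℝ}
    (hRm : ∀ b i j, ∑ k, Rm b k i * Rm b k j = if i = j then (1 : ℝ) else 0) {c : UT N × Fin d → ℝ}
    (hc : ∀ b, c b ≠ 0) {W : Fin 3 → UT N → ℝ} (hW : ∀ l x, 0 ≤ W l x) {a : Fin 3 → ℝ} (ha : ∀ l, 0 < a l)
    (hcov : ∀ x, ∃ l, 0 < W l x) : IsUnit (threeLevelOp (torusComb hM₀ hdiv₀) (torusComb hM hdiv) Rm c W a) :=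
  isUnit_threeLevelOp _ _ Rm hRm hc hW ha hcov

end Torus

/-! ## §7  Twins -/

section Twins

/-- **NEGATIVE TWIN (the covering hypothesis is used)**: on the bondless two-site lattice `Fin 2` (no bonds, so
Δ_U = 0 and every field is covariantly constant) with ONE identity level carried by the site 0 only (W = 𝟙_{0},
a = 1, T = 1 — isometric and reproducing), the indicator of the UNCOVERED site 1 is in the kernel: the level
operator is NOT a unit. [folklore] -/
theorem not_isUnit_levelOp_uncovered :
    ¬ IsUnit (levelOp (Cp := Fin 1) (Empty.elim : Empty → Fin 2) Empty.elim Empty.elim (fun b => b.elim)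
      (fun (_ : Unit) (x : Fin 2) => x) (fun _ x => if x = 0 then (1 : ℝ) else 0)
      (fun _ _ i j => if i = j then (1 : ℝ) else 0) (fun _ => 1)) := by
  have hf : (fun p : Fin 2 × Fin 1 => if p.1 = 0 then (0 : ℝ) else 1) ≠ 0 := by
    intro h
    have h1 : (if (1 : Fin 2) = 0 then (0 : ℝ) else 1) = 0 := congrFun h ((1 : Fin 2), (0 : Fin 1))
    rw [if_neg (by decide)] at h1
    exact one_ne_zero h1
  have hD : covD (Empty.elim : Empty → Fin 2) Empty.elim Empty.elim (fun b => b.elim)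
      (fun p : Fin 2 × Fin 1 => if p.1 = 0 then (0 : ℝ) else 1) = 0 := by
    funext q
    exact q.1.elim
  have hG : gMean (fun x : Fin 2 => x) (fun x => if x = 0 then (1 : ℝ) else 0)
      (fun (_ : Fin 2) (i j : Fin 1) => if i = j then (1 : ℝ) else 0)
      (fun p : Fin 2 × Fin 1 => if p.1 = 0 then (0 : ℝ) else 1) = 0 :=
    gMean_eq_zero_of_mul_eq_zero _ _ _ fun x i => by
      by_cases hx : x = 0
      · rw [if_pos hx, if_pos hx, mul_zero]
      · rw [if_neg hx, if_neg hx, zero_mul]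
  refine not_isUnit_of_apply_eq_zero hf ?_
  rw [levelOp, LinearMap.add_apply, LinearMap.comp_apply, hD, map_zero, zero_add, levelSum, Finset.univ_unique,
    Finset.sum_singleton, LinearMap.smul_apply, LinearMap.comp_apply, hG, map_zero, smul_zero]

/-- **POSITIVE TWIN on the twist witness**: on the 8-point circle with the flat quarter-turn transport `Rm8` of
`B9Thm37GlueTorusTwist` (where every U-independent block mean gives a NON-unit, `not_isUnit_twist8`), the
three-level operator over the two 4-blocks (`comb8`) and the one 8-block (`comb8c`) IS a unit (all c(b) ≠ 0, site
weights ≥ 0 covering, coefficients > 0). [folklore] -/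
theorem isUnit_threeLevel_twist8 (c : UT N8 × Fin 1 → ℝ) (hc : ∀ b, c b ≠ 0) {W : Fin 3 → UT N8 → ℝ}
    (hW : ∀ l x, 0 ≤ W l x) (hcov : ∀ x, ∃ l, 0 < W l x) {a : Fin 3 → ℝ} (ha : ∀ l, 0 < a l) :
    IsUnit (threeLevelOp comb8 comb8c Rm8 c W a) :=
  isUnit_threeLevelOp comb8 comb8c Rm8 hRm_Rm8 hc hW ha hcov

end Twins

end Literature.MathematicalPhysics.QuantumFieldTheory.Balaban1983to89.B9Thm37GlueTorusCovLevels
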